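import Summits.BirchSwinnertonDyer.BirchSwinnertonDyer.Theorems.Rank1ResidualX9Defs
import Literature.NumberTheory.EllipticCurves.Rank1Residual.FirstLayerCertificates
import HarnessLib
import HarnessLib.Audit

/-!
# FIRST-LAYER CRITERIA for statement (A): «`rank_p Cl(ℚ₁(P)) ≤ p − 1` ⟹ (A)» (δ) and «mod-`p`
# capitulation `Cl(ℚ(P))/p → Cl(ℚ₁(P))/p = 0` ⟹ (A)» (ε) on clean tame pairs — the cell's descent-lens
# gen-2 THEOREM-GRADE candidates, filed as obligation nodes (`@[conjecture] def`: typed ≠ proved)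

HONEST FRAMING (cell `bsd-f3-mu`, D-0131 (3) FRONTIER TIER, HOME `run/shared/lean/pub/bsd-f3-mu/`).
TYPER's filing of the `-desc` lens's generation-2 statements (MEMO-desc §10, `HOME/desc/Sketch3.lean`
sha16 e2de64f946f7738f, rc 0).  STATUS: both criteria are THEOREM-GRADE ON PAPER (MEMO-desc §10.1–10.2;
refuter `-ref1` g2 §3.4: «statements faithful; SURVIVE; proof steps (iii) local kernel and (vi) checked»;
refuter `-ref2` g3: NOT IN PRINT as stated — classical skeleton Lang, *Cyclotomic Fields I–II* Ch. 13 §1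
Lemma 3 «`rank_p V_n = r₁pⁿ + O(1)`; `μ = 0 ⟺` bounded», the lens's delta being `O(1) = 0` by perfect
control on clean pairs) and NOT YET PROVED IN LEAN (the proof needs the isotypic residual-fine-Selmer /
class-group dictionary, definition requests D4/D5 — not in the tree).  They are filed as `@[conjecture]`
obligation nodes in the cell's sense «typed, to be proved» (as `X10.CoreTheoremAOddPrime` was before its
`_holds`), so that lines can name them as stubs and the per-pair glue
(`Literature/…/Rank1Residual/FirstLayerCertificates.lean` §3, `Rank1Residual.ConjAAt.katoDivisibilityAt`)
can consume them BY NAME; a pure CONJECTURE LEAF (no theorem here; edges in `FirstLayerCriteriaEdges.lean`).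

MECHANISM (MEMO-desc §10, paper): on a CLEAN tame pair (`E[p]` irreducible, `p ∤ #Gal(ℚ(E[p])/ℚ)`,
`E(ℚ_v)[p] = 0` at `v = p` and bad `v`) the residual fine Selmer group is `Hom_G(Cl(ℚ_n(E[p]))/p, E[p])`
with PERFECT control along `ℚ_∞/ℚ`, `R'(ℚ_∞)^∨ = Y/pY` (`Y = X₀(E/ℚ_∞)`), whence the exact growth law
`m_n = r·pⁿ + Σ_j min(a_j, pⁿ)` and (A) ⟺ `r = 0`; transferred to `F = ℚ(P)` (`p ∤ #Stab P`,
`E[p]^{Stab P} ∋ P`): δ — an `Ω`-free summand forces a Jordan block of size `p` at layer 1, so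
`rank_p Cl(F₁) ≤ p − 1 ⟹ r = 0`; ε — the trace `T^{p−1} = j ∘ N` on `Cl(F₁)/p` with `N` onto, so
`Im j = T^{p−1}(Cl(F₁)/p)`, non-zero on the `E[p]`-part iff some block has size `p`, which `r ≥ 1` forces
(ε contains Deo–Ray–Sujatha's α: `p ∤ h(ℚ(P))`).  DETECTOR: `¬(A)` ⟹ `rank_p Cl(F_n) ≥ pⁿ` and
non-capitulation at every layer.  BC5 / data: certificates are per pair (column d9 requested from `-data`:
`rkF`, `rkF1`, `cap`; reach 130 5Ns + 36 7Ns of 790 X9 pairs and 883/883 X10b; 5S4 degree 120 out of reach).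

References: [DeoRaySujatha2023] §3 (c1)–(c3), Thm. 3.9, Lemma 5.1; [Lang1990] Ch. 13 §1 Lemma 3;
[CoatesSujatha2005] §3; HOME MEMO-desc.md §10, desc/Sketch3.lean, REF1-AUDIT.md §3.4, REF2-LITMAP.md §3,
CANDIDATES.md §1 rows 13–14.
-/

-- the summit and its single problem are both named `BirchSwinnertonDyer` (registry layout D-0017)
set_option linter.dupNamespace false

noncomputable section

open scoped Classical

open WeierstrassCurve Literature.NumberTheory.EllipticCurves Literature.NumberTheory.IwasawaTheory
  Summit.BirchSwinnertonDyer.BirchSwinnertonDyer.Rank1Residual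
open Literature.NumberTheory.EllipticCurves.Rank1Residual (ConjAAt TameAt CleanAt FirstLayerRankCertAt
  FirstLayerCapitulationCertAt)

namespace Summit.BirchSwinnertonDyer.Rank1Residual.SmallImageMu

/-- **δ — FIRST-LAYER RANK CRITERION (theorem-grade on paper, MEMO-desc §10.1; NOT proved in Lean;
nothing asserted).**  For `p` odd, `E[p]` irreducible, tame (`Rank1Residual.TameAt`) and clean
(`Rank1Residual.CleanAt`): if for one non-zero `P ∈ E[p]` every cyclotomic `ℤ_p`-extension of `ℚ(P)` has
`rank_p Cl(ℚ₁(P)) ≤ p − 1` (`Rank1Residual.FirstLayerRankCertAt`), then statement (A) holds at the pair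
(`Rank1Residual.ConjAAt`).  Verbatim the audited `HOME/desc/Sketch3.lean`.
[cite: Lang1990, Ch. 13 §1 Lemma 3 — the classical first-layer skeleton; the criterion itself is the cell's claim, not in print]
[cite: DeoRaySujatha2023, Thm. 3.9 (arXiv:2202.09937 pp. 9–10) — the layer-0 criterion it refines] -/
@[conjecture] def FirstLayerRankCriterion : Prop :=
  ∀ (W : WeierstrassCurve ℚ) [W.IsElliptic] (p : ℕ) [Fact p.Prime], p ≠ 2 →
    W.HasIrreducibleModPGaloisRep p → TameAt W p → CleanAt W p →
    FirstLayerRankCertAt W p → ConjAAt W p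

/-- **ε — FIRST-LAYER CAPITULATION CRITERION (theorem-grade on paper, MEMO-desc §10.2; NOT proved in
Lean; nothing asserted).**  For `p` odd, `E[p]` irreducible, tame and clean: if for one non-zero `P ∈ E[p]`
every cyclotomic `ℤ_p`-extension `κ` of `ℚ(P)` has `Cl(ℚ(P))/p → Cl(ℚ₁(P))/p` zero
(`Rank1Residual.FirstLayerCapitulationCertAt`), then statement (A) holds at the pair.  Contains
Deo–Ray–Sujatha Thm 3.9 (`p ∤ h(ℚ(P))` ⟹ the map is zero).  Verbatim the audited Sketch3.
[cite: DeoRaySujatha2023, Thm. 3.9 (b) (arXiv:2202.09937 pp. 9–10) — contained special case] [cite: Lang1990, Ch. 13 §1 Lemma 3] -/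
@[conjecture] def FirstLayerCapitulationCriterion : Prop :=
  ∀ (W : WeierstrassCurve ℚ) [W.IsElliptic] (p : ℕ) [Fact p.Prime], p ≠ 2 →
    W.HasIrreducibleModPGaloisRep p → TameAt W p → CleanAt W p →
    FirstLayerCapitulationCertAt W p → ConjAAt W p

end Summit.BirchSwinnertonDyer.Rank1Residual.SmallImageMu

end
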